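import Literature.AnabelianGeometry.AbsoluteAnabelian.AbsTopIThm26viCyclotomicInstance
import Literature.AnabelianGeometry.AbsoluteAnabelian.AbsTopIThm26vProofs
import Literature.AnabelianGeometry.AbsoluteAnabelian.AbsAnabFundamentalGroupsSchemaNegative
import Literature.AnabelianGeometry.EtaleTheta.CyclotomeGaloisFixedPoints
import HarnessLib

/-!
# [AbsTopI] Thm 2.6 (v) AS TYPED (`FundamentalExtension.Thm26v`, FACT-LIST F-0249) and [AbsAnab] Lemma
# 1.1.4 (ii) (∗) / rank constancy (F-0012 `StarCondition`, F-0001 `CoinvariantRankConstant`): instance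
# forms PROVED at the cyclotomic extensions `1 → ℤ_ℓ(1) → ℤ_ℓ(1) ⋊_χ G_K → G_K → 1`, `K` an MLF

S. Mochizuki, *Topics in Absolute Anabelian Geometry I: Generalities*, J. Math. Sci. Univ. Tokyo 19 (2012)
[MochizukiAbsTopI2012], Thm 2.6 (v), manuscript p. 22, proof p. 24 ("[cf. [Mzk6], Lemma 1.1.4, (ii)]");
S. Mochizuki, *The absolute anabelian geometry of hyperbolic curves* (2004) [MochizukiAbsAnab2004], Lemma
1.1.4 (ii) p. 7 with its condition (∗) and the p. 8 rank argument.

PROOF-ONLY companion (no definition, no instance, no named fact), abc-iut cell seat abc-iut-f-091 (gen 2),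
fourth file on FACT-LIST row **F-0249** `FundamentalExtension.Thm26v` after `AbsTopISemiAbsoluteSchemaNegative`
(universal closure REFUTED), `AbsTopIThm26vSchemaNegativeTfg` (refuted in the `Δ`-tfg regime when rank
constancy fails) and `AbsTopIThm26vviPointInstances` (PROVED at the DEGENERATE point extension `Π = G`); MLF
twin of `AbsTopIThm26viCyclotomicInstance` (Thm 2.6 (vi) at `ℤ_p(1) ⋊_χ G_ℚ`).  Here, for EVERY finite
extension `K` of `ℚ_p` and EVERY prime `ℓ`, the extension

  `E_χ :  1 → ℤ_ℓ(1) → ℤ_ℓ(1) ⋊_χ G_K → G_K → 1`,   `χ = χ_ℓ : G_K → ℤ_ℓ^×` the `ℓ`-adic cyclotomic character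

(the tree's continuous `GaloisRep.cyclotomicCharacter K ℓ`; topology along `g ↦ (g.left, g.right)`, generic
`SettingModel.Semidirect` plumbing) — by Kummer theory (not constructed here: no étale `π₁` in the tree) the
geometrically pro-`ℓ` AFG-type extension of [AbsTopI] Def 2.1 (ii) with construction data
`(k, X, Y, Σ) = (K, 𝔾_m, 𝔾_m, {ℓ})`, `K` an MLF, `ℓ` invertible in `K` — satisfies:

* **(∗) of [AbsAnab] Lemma 1.1.4 (ii) (`StarCondition`, F-0012) with `Q'' = 0` for every open `Π'' ⊆ Π`**: the
  maximal torsion-free quotient of `(Δ'')^{ab}` with trivial `G''`-action VANISHES — `Δ'' = ℤ_ℓ ∩ Π''` is an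
  `ℓ`-adic lattice, some `π ∈ Π''` acts on it as multiplication by `c = χ(π̄) ≠ 1` (the cyclotomic character
  of an MLF is non-trivial on EVERY open subgroup: `exists_mem_cyclotomicCharacter_ne_one_of_isOpen`, from the
  finiteness of the roots of unity of a `p`-adic field — the tree's
  `EtaleTheta.exists_exponent_rootsOfUnity_of_finiteDimensional`, Neukirch *ANT* II (5.7) (i) — and the
  Krull correspondence, Mathlib `InfiniteGalois`), so the commutators `[π, δ] = (c − 1)·δ` together with
  root-closure exhaust `Δ''` (`geom_inf_le_coinvRadical_of_conj_eq_mul`, any `Π` with `Δ ≅ ℤ_ℓ`);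
* hence **rank constancy `CoinvariantRankConstant` (F-0001)** by the landed p. 8 derivation
  `coinvariantRankConstant_of_mlfBase` ((∗) + splitting), and
* **[AbsTopI] Thm 2.6 (v) AS TYPED (`Thm26v`, F-0249)**: `ζ(Π) = [K : ℚ_p]` and
  `Δ = ⋂ {H open | ζ(H) = [Π : H]·ζ(Π)}`, by abc-iut-L4's landed `thm26v_of_starCondition` (inputs: the
  splitting, `Δ` tfg, (∗); ultimately the tree's local class field theory `thm26_ii_delta_gal_holds`).

So the three MLF-side schema rows F-0001 / F-0012 / F-0249, so far kernel-witnessed only at DEGENERATE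
instances (`Δ = 1`: `coinvariantRankConstant_absoluteGalois_padicTwo`, `starCondition_of_geom_eq_bot`,
`MLFBase.thm26v_of_geom_eq_bot`), now hold at a NON-DEGENERATE extension with genuine arithmetic (`Δ ≅ ℤ_ℓ`,
non-trivial outer Galois action through `χ_ℓ`).  The typed `Thm26v` is the tree's `Θ = {1}` reading of
print's (v); whether print's case distinction selects `Θ = {1}` for this construction datum is not examined
here — the file proves the TYPED predicate.
HONEST FRAMING: [AbsTopI]/[AbsAnab] are refereed, undisputed papers; the model is a group-theoretic
construction whose identification with `π₁(𝔾_{m,K})^{(ℓ)}` is classical Kummer theory, NOT kernel-checked;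
nothing here bears on the disputed [IUTchIII] Cor. 3.12 or takes a side on any author; typed ≠ proved elsewhere.
-/

noncomputable section

open Topology

universe u

namespace Literature.AnabelianGeometry.AbsoluteAnabelian

open Literature.NumberTheory.GaloisRepresentations
open Literature.AnabelianGeometry.EtaleTheta
open Literature.AnabelianGeometry.EtaleTheta.SettingModel

/-! ## The `ℓ`-adic cyclotomic character of an MLF is non-trivial on every open subgroup -/

/-- **For a finite extension `K` of `ℚ_p`, a prime `ℓ` and an OPEN subgroup `U ⊆ G_K`, the `ℓ`-adic
cyclotomic character is non-trivial on `U`** (`K(μ_{ℓ^∞})/K` is an infinite extension).  Proof: the fixed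
field `L` of `U` is a finite extension of `K` (Krull correspondence), the roots of unity of the `p`-adic field
`L` are killed by one exponent `M` (Neukirch *ANT* II (5.7) (i), the tree's
`exists_exponent_rootsOfUnity_of_finiteDimensional`), yet if `χ_ℓ|_U = 1` then `U` fixes a primitive
`ℓ^M`-th root of unity, which then lies in `L` — forcing `ℓ^M ∣ M`, absurd.  (Used for [AbsTopI] Thm 2.6 (v)
at the cyclotomic model: the outer action of every open `Π'' ⊆ Π` on `Δ'' ⊆ ℤ_ℓ(1)` is non-trivial.)
[cite: NeukirchANT1999, Ch. II Prop. (5.7) (i)] -/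
theorem exists_mem_cyclotomicCharacter_ne_one_of_isOpen (p : ℕ) [Fact p.Prime] (K : Type u) [Field K]
    [Algebra ℚ_[p] K] [FiniteDimensional ℚ_[p] K] (ℓ : ℕ) [Fact ℓ.Prime]
    (U : Subgroup (Field.absoluteGaloisGroup K)) (hU : IsOpen (U : Set (Field.absoluteGaloisGroup K))) :
    ∃ σ ∈ U, GaloisRep.cyclotomicCharacter K ℓ σ ≠ 1 := by
  classical
  haveI : CharZero K := charZero_of_injective_algebraMap (algebraMap ℚ_[p] K).injective
  have hℓ : ℓ.Prime := Fact.out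
  by_contra h
  push Not at h
  -- the fixed field of `U` is a finite extension of `K`, hence of `ℚ_p`
  set L : IntermediateField K (AlgebraicClosure K) := IntermediateField.fixedField U with hLdef
  have hLU : L.fixingSubgroup = U :=
    InfiniteGalois.fixingSubgroup_fixedField ⟨U, U.isClosed_of_isOpen hU⟩
  haveI : FiniteDimensional K L := by
    refine (InfiniteGalois.isOpen_iff_finite L).mp ?_
    change IsOpen (L.fixingSubgroup : Set (AlgebraicClosure K ≃ₐ[K] AlgebraicClosure K))
    rw [hLU]
    exact hU
  haveI : FiniteDimensional ℚ_[p] L := FiniteDimensional.trans ℚ_[p] K L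
  obtain ⟨M, hM, hkill⟩ := exists_exponent_rootsOfUnity_of_finiteDimensional p (↥L)
  -- a primitive `ℓ^M`-th root of unity of `K̄`
  haveI : NeZero ((ℓ ^ M : ℕ) : AlgebraicClosure K) :=
    ⟨by exact_mod_cast pow_ne_zero M hℓ.ne_zero⟩
  obtain ⟨ζ, hζ⟩ := HasEnoughRootsOfUnity.exists_primitiveRoot (AlgebraicClosure K) (ℓ ^ M)
  -- `U` fixes `ζ`, since `χ_ℓ|_U = 1`
  haveI : NeZero (ℓ : K) := ⟨by exact_mod_cast hℓ.ne_zero⟩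
  haveI : Fact (1 < ℓ ^ M) := ⟨Nat.one_lt_pow hM.ne' hℓ.one_lt⟩
  have hfix : ∀ σ : AlgebraicClosure K ≃ₐ[K] AlgebraicClosure K, σ ∈ U → σ ζ = ζ := by
    intro σ hσ
    have hspec :=
      GaloisRep.cyclotomicCharacter_spec K ℓ (k := M) (σ : Field.absoluteGaloisGroup K) ζ hζ.pow_eq_one
    rw [h σ hσ, Units.val_one, map_one, ZMod.val_one, pow_one] at hspec
    exact hspec
  have hmem : ζ ∈ L := by
    rw [hLdef, IntermediateField.mem_fixedField_iff]
    exact hfix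
  have hfo : IsOfFinOrder (⟨ζ, hmem⟩ : L) :=
    isOfFinOrder_iff_pow_eq_one.mpr ⟨ℓ ^ M, pow_pos hℓ.pos M, Subtype.ext (by
      rw [SubmonoidClass.coe_pow]
      exact hζ.pow_eq_one)⟩
  have hζM : ζ ^ M = 1 := by
    have h1 := congrArg (fun y : L => (y : AlgebraicClosure K)) (hkill _ hfo)
    simpa only [SubmonoidClass.coe_pow, OneMemClass.coe_one] using h1
  have hdvd : ℓ ^ M ∣ M := hζ.dvd_of_pow_eq_one M hζM
  exact absurd (Nat.le_of_dvd hM hdvd) (not_le.mpr (Nat.lt_pow_self hℓ.one_lt))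

/-! ## Closed subgroups of `ℤ_ℓ` are `ℤ_ℓ`-submodules -/

/-- A CLOSED subgroup of `ℤ_ℓ` (written multiplicatively) is stable under multiplication by `ℓ`-adic
integers: it contains the `ℤ`-multiples of its elements and `ℤ` is dense in `ℤ_ℓ`.  (So `Δ ∩ Π''`, for
`Π''` open in a `Π` with `Δ ≅ ℤ_ℓ`, is an `ℓ`-adic lattice.) [cite: MochizukiAbsAnab2004, Lemma 1.1.4 (ii) p.7] -/
theorem ofAdd_mul_mem_of_isClosed {ℓ : ℕ} [Fact ℓ.Prime] (S : Subgroup (Multiplicative ℤ_[ℓ]))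
    (hS : IsClosed (S : Set (Multiplicative ℤ_[ℓ]))) {a : ℤ_[ℓ]} (ha : Multiplicative.ofAdd a ∈ S)
    (t : ℤ_[ℓ]) : Multiplicative.ofAdd (t * a) ∈ S := by
  let T : Set ℤ_[ℓ] := {t | Multiplicative.ofAdd (t * a) ∈ S}
  have hT : IsClosed T :=
    hS.preimage (continuous_ofAdd.comp (continuous_id.mul continuous_const))
  have hZ : Set.range (Int.cast : ℤ → ℤ_[ℓ]) ⊆ T := by
    rintro _ ⟨n, rfl⟩
    change Multiplicative.ofAdd ((n : ℤ_[ℓ]) * a) ∈ S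
    rw [← zsmul_eq_mul, ofAdd_zsmul]
    exact S.zpow_mem ha n
  have huniv : T = Set.univ := by
    apply Set.eq_univ_of_univ_subset
    rw [← (PadicInt.denseRange_intCast (p := ℓ)).closure_range]
    exact closure_minimal hZ hT
  have ht : t ∈ T := by rw [huniv]; exact Set.mem_univ t
  exact ht

namespace FundamentalExtension

/-! ## (∗) of [AbsAnab] Lemma 1.1.4 (ii) with `Q'' = 0`: scalar action by `c ≠ 1` exhausts `Δ''` -/

/-- **The mechanism behind (∗) at a rank-one geometric group.**  Let `1 → Δ → Π → G → 1` be ANY extension of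
profinite groups with `Δ` the image of a continuous `j : ℤ_ℓ → Π`, `Π'' ⊆ Π` open, and suppose some
`π ∈ Π''` acts on `Δ` as multiplication by an `ℓ`-adic integer `c ≠ 1`.  Then the radical of (∗) — the
smallest closed, normal, root-closed subgroup of `Δ'' = Δ ∩ Π''` containing the commutators `[π', δ]`
(`π' ∈ Π''`, `δ ∈ Δ''`) — is ALL of `Δ''`: with `c − 1 = u·ℓ^k` and `δ = j(a) ∈ Δ''`, also `j(u⁻¹a) ∈ Δ''`
(`Δ''` is an `ℓ`-adic lattice) and `[π, j(u⁻¹a)] = j(ℓ^k a) = δ^{ℓ^k}`, so root-closure gives `δ`.  I.e. the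
maximal torsion-free `G''`-trivial quotient `Q''` of `(Δ'')^{ab}` VANISHES.
[cite: MochizukiAbsAnab2004, Lemma 1.1.4 (ii) p.7] -/
theorem geom_inf_le_coinvRadical_of_conj_eq_mul (E : FundamentalExtension.{u}) {ℓ : ℕ} [Fact ℓ.Prime]
    (j : Multiplicative ℤ_[ℓ] →ₜ* E.arith) (hj : j.toMonoidHom.range = E.geom)
    (P : Subgroup E.arith) (hP : IsOpen (P : Set E.arith)) (π : E.arith) (hπ : π ∈ P)
    (c : ℤ_[ℓ]) (hc : c ≠ 1)
    (hconj : ∀ a : ℤ_[ℓ],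
      π * j (Multiplicative.ofAdd a) * π⁻¹ = j (Multiplicative.ofAdd (c * a))) :
    E.geom ⊓ P ≤ E.coinvRadical P := by
  have hℓ : ℓ.Prime := Fact.out
  intro x hx
  obtain ⟨hxΔ, hxP⟩ := Subgroup.mem_inf.mp hx
  have hmem : ∀ a : ℤ_[ℓ], j (Multiplicative.ofAdd a) ∈ E.geom := fun a => hj ▸ ⟨_, rfl⟩
  -- `x = j a`
  have hxr : x ∈ j.toMonoidHom.range := hj ▸ hxΔ
  obtain ⟨m, hm⟩ := hxr
  set a : ℤ_[ℓ] := Multiplicative.toAdd m with ha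
  have hxa : x = j (Multiplicative.ofAdd a) := by rw [ha, ofAdd_toAdd]; exact hm.symm
  -- the closed subgroup `S = j⁻¹(Π'')` of `ℤ_ℓ`, an `ℓ`-adic lattice
  let S : Subgroup (Multiplicative ℤ_[ℓ]) := P.comap j.toMonoidHom
  have hS : IsClosed (S : Set (Multiplicative ℤ_[ℓ])) :=
    (P.isClosed_of_isOpen hP).preimage (map_continuous j)
  have haS : Multiplicative.ofAdd a ∈ S := by
    change j (Multiplicative.ofAdd a) ∈ P
    rw [← hxa]
    exact hxP
  -- `c - 1 = v * ℓ^k`, `v` a unit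
  have hc1 : c - 1 ≠ 0 := sub_ne_zero.mpr hc
  set k := (c - 1).valuation
  set v : ℤ_[ℓ]ˣ := PadicInt.unitCoeff hc1
  have hspec : c - 1 = (v : ℤ_[ℓ]) * (ℓ : ℤ_[ℓ]) ^ k := PadicInt.unitCoeff_spec hc1
  -- `a'' := v⁻¹ a` still lies in `S`
  have ha'' : Multiplicative.ofAdd (((v⁻¹ : ℤ_[ℓ]ˣ) : ℤ_[ℓ]) * a) ∈ S :=
    ofAdd_mul_mem_of_isClosed S hS haS _
  -- membership in every subgroup of the radical's defining family
  change x ∈ sInf _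
  rw [Subgroup.mem_sInf]
  rintro B ⟨-, -, -, hBroot, hBcomm⟩
  have hδ : j (Multiplicative.ofAdd (((v⁻¹ : ℤ_[ℓ]ˣ) : ℤ_[ℓ]) * a)) ∈ E.geom ⊓ P :=
    Subgroup.mem_inf.mpr ⟨hmem _, ha''⟩
  have hcomm := hBcomm π hπ _ hδ
  -- the commutator is `x ^ ℓ^k`
  have hre : π * j (Multiplicative.ofAdd (((v⁻¹ : ℤ_[ℓ]ˣ) : ℤ_[ℓ]) * a)) * π⁻¹ *
      (j (Multiplicative.ofAdd (((v⁻¹ : ℤ_[ℓ]ˣ) : ℤ_[ℓ]) * a)))⁻¹ = x ^ (ℓ ^ k) := by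
    rw [hconj, ← map_inv, ← map_mul, ← ofAdd_neg, ← ofAdd_add, hxa, ← map_pow, ← ofAdd_nsmul]
    congr 2
    rw [nsmul_eq_mul, Nat.cast_pow, ← sub_eq_add_neg]
    calc c * (((v⁻¹ : ℤ_[ℓ]ˣ) : ℤ_[ℓ]) * a) - ((v⁻¹ : ℤ_[ℓ]ˣ) : ℤ_[ℓ]) * a
        = (c - 1) * ((((v⁻¹ : ℤ_[ℓ]ˣ) : ℤ_[ℓ])) * a) := by ring
      _ = (ℓ : ℤ_[ℓ]) ^ k * a := by
          rw [hspec, mul_comm (v : ℤ_[ℓ]) _, mul_assoc, ← mul_assoc (v : ℤ_[ℓ]), Units.mul_inv, one_mul]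
  rw [hre] at hcomm
  exact hBroot x hx (ℓ ^ k) (pow_pos hℓ.pos k) hcomm

/-- Consequently **(∗) holds with `m = 0`** (`Q'' = 0`, `Δ''/R = 1 ≅ Ẑ^0`) for an extension with `Δ ≅ ℤ_ℓ`
as soon as every open `Π'' ⊆ Π` contains an element acting on `Δ` by a scalar `≠ 1`.
[cite: MochizukiAbsAnab2004, Lemma 1.1.4 (ii) p.7] -/
theorem starCondition_of_conj_eq_mul (E : FundamentalExtension.{0}) {ℓ : ℕ} [Fact ℓ.Prime]
    (j : Multiplicative ℤ_[ℓ] →ₜ* E.arith) (hj : j.toMonoidHom.range = E.geom)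
    (h : ∀ (P : Subgroup E.arith), IsOpen (P : Set E.arith) →
      ∃ π ∈ P, ∃ c : ℤ_[ℓ], c ≠ 1 ∧
        ∀ a : ℤ_[ℓ], π * j (Multiplicative.ofAdd a) * π⁻¹ = j (Multiplicative.ofAdd (c * a))) :
    E.StarCondition := by
  intro P hP
  obtain ⟨π, hπ, c, hc, hconj⟩ := h P hP
  refine ⟨0, ContinuousMonoidHom.mk 1 continuous_const, fun t => ⟨1, (hatZPow_zero_eq_one t).symm⟩,
    fun x => ⟨fun _ => ?_, fun _ => rfl⟩⟩
  exact E.geom_inf_le_coinvRadical_of_conj_eq_mul j hj P hP π hπ c hc hconj x.2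

/-! ## The cyclotomic extensions `1 → ℤ_ℓ(1) → ℤ_ℓ(1) ⋊_χ G_K → G_K → 1`, `K` an MLF -/

/-- **FACT-LIST F-0249 / F-0012 / F-0001: [AbsTopI] Thm 2.6 (v) AS TYPED, (∗) of [AbsAnab] Lemma 1.1.4 (ii)
and rank constancy all hold at the cyclotomic extension `1 → ℤ_ℓ(1) → ℤ_ℓ(1) ⋊_χ G_K → G_K → 1`** — the
group-theoretic model of the geometrically pro-`ℓ` AFG-type extension of `X = 𝔾_m` over the MLF `K` ([AbsTopI]
Def 2.1 (ii), construction data `(K, 𝔾_m, 𝔾_m, {ℓ})`, up to the Kummer identification `π₁(𝔾_{m,K̄})^{(ℓ)} =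
ℤ_ℓ(1)`, not constructed here), for every finite extension `K` of `ℚ_p` and every prime `ℓ`.  Recorded as an
existential over the tree's vocabulary, with MLF base datum `(p, K, i)`: there are an extension `E`, an
identification `i : G ≅ G_K` and a continuous embedding `j : ℤ_ℓ ↪ Π` with image `Δ` such that (a) `Π` acts
on `Δ` through the `ℓ`-adic cyclotomic character of `G_K` composed with the augmentation ("`Δ = ℤ_ℓ(1)`");
(b) `E` splits ([AbsAnab] §1.1), `Δ` is topologically finitely generated ([AbsTopI] Prop 2.2) and `Δ ≠ 1`;
(c) `E.StarCondition` ((∗), F-0012: here `Q'' = 0` for every open `Π''`); (d) `E.CoinvariantRankConstant`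
(F-0001, by the landed `coinvariantRankConstant_of_mlfBase`); (e) `E.Thm26v (p, K, i)` (F-0249, by the landed
`thm26v_of_starCondition`): `ζ(Π) = [K : ℚ_p]` and `Δ = ⋂ {H open | ζ(H) = [Π : H]·ζ(Π)}`.
Inputs by name: `GaloisRep.cyclotomicCharacter K ℓ`, `exists_mem_cyclotomicCharacter_ne_one_of_isOpen`
(Neukirch II (5.7) (i) via the tree), `thm26v_of_starCondition`, `coinvariantRankConstant_of_mlfBase`,
`SettingModel.Semidirect.*`. [cite: MochizukiAbsTopI2012, Thm 2.6 (v) p.22]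
[cite: MochizukiAbsAnab2004, Lemma 1.1.4 (ii) p.7] -/
theorem exists_cyclotomicModel_thm26v (p : ℕ) [Fact p.Prime] (K : Type) [Field K] [Algebra ℚ_[p] K]
    [FiniteDimensional ℚ_[p] K] (ℓ : ℕ) [Fact ℓ.Prime] :
    ∃ (E : FundamentalExtension.{0}) (i : E.gal ≃ₜ* Field.absoluteGaloisGroup K)
      (j : Multiplicative ℤ_[ℓ] →ₜ* E.arith),
      Function.Injective j ∧ j.toMonoidHom.range = E.geom ∧
      (∀ (g : E.arith) (a : ℤ_[ℓ]), g * j (Multiplicative.ofAdd a) * g⁻¹ =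
        j (Multiplicative.ofAdd
          (((GaloisRep.cyclotomicCharacter K ℓ (i (E.aug g)) : ℤ_[ℓ]ˣ) : ℤ_[ℓ]) * a))) ∧
      E.SplitsOverOpenSubgroup ∧ E.GeomTFG ∧ E.geom ≠ ⊥ ∧
      E.StarCondition ∧ E.CoinvariantRankConstant ∧
      E.Thm26v { p := p, K := K, galIso := i } := by
  classical
  haveI : CharZero K := charZero_of_injective_algebraMap (algebraMap ℚ_[p] K).injective
  let Z : Type := Multiplicative ℤ_[ℓ]
  let Γ : Type := Field.absoluteGaloisGroup K
  let χ : Γ →ₜ* ℤ_[ℓ]ˣ := GaloisRep.cyclotomicCharacter K ℓ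
  -- the action of `G_K` on `ℤ_ℓ(1)`: `σ ↦ (x ↦ χ(σ) • x)`
  let φ : Γ →* MulAut Z :=
    ((MulAutMultiplicative ℤ_[ℓ]).symm.toMonoidHom.comp AddAut.mulLeft).comp χ.toMonoidHom
  have hφ : ∀ (σ : Γ) (x : Z),
      φ σ x = Multiplicative.ofAdd (((χ σ : ℤ_[ℓ]ˣ) : ℤ_[ℓ]) * Multiplicative.toAdd x) := fun _ _ => rfl
  -- the topology of `ℤ_ℓ(1) ⋊_χ G_K`: induced along `g ↦ (g.left, g.right)`
  letI τ : TopologicalSpace (Z ⋊[φ] Γ) :=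
    TopologicalSpace.induced (fun g : Z ⋊[φ] Γ => (g.left, g.right)) inferInstance
  have hι : IsInducing fun g : Z ⋊[φ] Γ => (g.left, g.right) := ⟨rfl⟩
  have hact : Continuous fun q : Γ × Z => φ q.1 q.2 := by
    have heq : (fun q : Γ × Z => φ q.1 q.2) = fun q =>
        Multiplicative.ofAdd (((χ q.1 : ℤ_[ℓ]ˣ) : ℤ_[ℓ]) * Multiplicative.toAdd q.2) :=
      funext fun q => hφ q.1 q.2
    rw [heq]
    exact continuous_ofAdd.comp
      ((Units.continuous_val.comp ((map_continuous χ).comp continuous_fst)).mul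
        (continuous_toAdd.comp continuous_snd))
  haveI : IsTopologicalGroup (Z ⋊[φ] Γ) := Semidirect.isTopologicalGroup_of_continuous_action hι hact
  haveI : CompactSpace (Z ⋊[φ] Γ) := Semidirect.compactSpace_of hι
  haveI : TotallyDisconnectedSpace (Z ⋊[φ] Γ) := Semidirect.totallyDisconnectedSpace_of hι
  -- the extension
  let E : FundamentalExtension.{0} :=
    { arith := ProfiniteGrp.of (Z ⋊[φ] Γ)
      gal := absoluteGaloisGrp K
      aug := Semidirect.rightHomCont hι
      aug_surjective := SemidirectProduct.rightHom_surjective }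
  let i : E.gal ≃ₜ* Γ := ContinuousMulEquiv.refl _
  let B : E.MLFBase := { p := p, K := K, galIso := i }
  let j : Z →ₜ* E.arith := ⟨SemidirectProduct.inl, Semidirect.continuous_inl hι⟩
  -- `Δ = ker(right) = inl(ℤ_ℓ)`
  have hmem_iff : ∀ g : E.arith, g ∈ E.geom ↔ (g : Z ⋊[φ] Γ).right = 1 := fun g => E.mem_geom
  have hrange : j.toMonoidHom.range = E.geom := by
    ext g
    rw [hmem_iff]
    constructor
    · rintro ⟨x, rfl⟩
      rfl
    · intro hg
      refine ⟨(g : Z ⋊[φ] Γ).left, ?_⟩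
      change SemidirectProduct.inl _ = g
      conv_rhs => rw [← SemidirectProduct.inl_left_mul_inr_right (g : Z ⋊[φ] Γ)]
      rw [hg, map_one, mul_one]
  have hinj : Function.Injective j := SemidirectProduct.inl_injective
  -- conjugation inside `ℤ_ℓ ⋊_φ G_K`: `(n,σ) · x · (n,σ)⁻¹ = φ σ x` (`ℤ_ℓ` is commutative)
  have key : ∀ (n x : Z) (σ : Γ),
      (SemidirectProduct.inl n * SemidirectProduct.inr σ : Z ⋊[φ] Γ) * SemidirectProduct.inl x *
        (SemidirectProduct.inl n * SemidirectProduct.inr σ)⁻¹ = SemidirectProduct.inl (φ σ x) := by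
    intro n x σ
    calc (SemidirectProduct.inl n * SemidirectProduct.inr σ : Z ⋊[φ] Γ) * SemidirectProduct.inl x *
          (SemidirectProduct.inl n * SemidirectProduct.inr σ)⁻¹
        = SemidirectProduct.inl n *
            (SemidirectProduct.inr σ * SemidirectProduct.inl x * SemidirectProduct.inr σ⁻¹) *
            (SemidirectProduct.inl n)⁻¹ := by
          rw [map_inv, mul_inv_rev]
          simp only [mul_assoc]
      _ = SemidirectProduct.inl (n * φ σ x * n⁻¹) := by
          rw [← SemidirectProduct.inl_aut, map_mul, map_mul, map_inv]
      _ = SemidirectProduct.inl (φ σ x) := by rw [mul_comm n, mul_inv_cancel_right]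
  -- (a) `Π` acts on `Δ` through `χ ∘ aug`
  have hconj : ∀ (g : E.arith) (a : ℤ_[ℓ]), g * j (Multiplicative.ofAdd a) * g⁻¹ =
      j (Multiplicative.ofAdd (((GaloisRep.cyclotomicCharacter K ℓ (i (E.aug g)) : ℤ_[ℓ]ˣ) : ℤ_[ℓ]) * a)) := by
    intro g a
    change (g : Z ⋊[φ] Γ) * SemidirectProduct.inl (Multiplicative.ofAdd a) * g⁻¹ =
      SemidirectProduct.inl (Multiplicative.ofAdd (((χ (g : Z ⋊[φ] Γ).right : ℤ_[ℓ]ˣ) : ℤ_[ℓ]) * a))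
    have h1 : (SemidirectProduct.inl
        (Multiplicative.ofAdd (((χ (g : Z ⋊[φ] Γ).right : ℤ_[ℓ]ˣ) : ℤ_[ℓ]) * a)) : Z ⋊[φ] Γ) =
        SemidirectProduct.inl (φ (g : Z ⋊[φ] Γ).right (Multiplicative.ofAdd a)) := by
      rw [hφ]
      rfl
    rw [h1, ← key (g : Z ⋊[φ] Γ).left (Multiplicative.ofAdd a) (g : Z ⋊[φ] Γ).right,
      SemidirectProduct.inl_left_mul_inr_right]
  -- (b) the extension splits: `σ ↦ (0, σ)` is a continuous section over all of `G_K`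
  have hsplit : E.SplitsOverOpenSubgroup := by
    refine ⟨⊤, (⟨SemidirectProduct.inr, Semidirect.continuous_inr hι⟩ : Γ →ₜ* (Z ⋊[φ] Γ)).comp
      ⟨(⊤ : Subgroup Γ).subtype, continuous_subtype_val⟩, ?_, fun u => rfl⟩
    rw [Subgroup.coe_top]
    exact isOpen_univ
  -- `Δ ≅ ℤ_ℓ` is topologically finitely generated ([AbsTopI] Prop 2.2 at the model)
  have htfg : E.GeomTFG := by
    let jΔ : Z →ₜ* E.geom :=
      ⟨(SemidirectProduct.inl : Z →* Z ⋊[φ] Γ).codRestrict E.geom (fun z => (hmem_iff _).mpr rfl),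
        (Semidirect.continuous_inl hι).subtype_mk _⟩
    have hjΔ : Function.Surjective jΔ := by
      rintro ⟨g, hg⟩
      refine ⟨(g : Z ⋊[φ] Γ).left, Subtype.ext ?_⟩
      change SemidirectProduct.inl _ = g
      conv_rhs => rw [← SemidirectProduct.inl_left_mul_inr_right (g : Z ⋊[φ] Γ)]
      rw [(hmem_iff g).mp hg, map_one, mul_one]
    exact (isTopologicallyFinitelyGenerated_multiplicative_padicInt ℓ).of_surjective jΔ hjΔ
  -- `Δ ≠ 1`
  have hne : E.geom ≠ ⊥ := by
    intro h
    have h1 : j (Multiplicative.ofAdd (1 : ℤ_[ℓ])) ∈ E.geom := hrange ▸ ⟨_, rfl⟩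
    rw [h, Subgroup.mem_bot] at h1
    have h2 : Multiplicative.ofAdd (1 : ℤ_[ℓ]) = 1 := hinj (by rw [h1, map_one])
    exact one_ne_zero (ofAdd_eq_one.mp h2)
  -- (c) condition (∗): every open `Π''` contains `π` with `χ(π̄) ≠ 1` (non-triviality of `χ_ℓ` on the
  -- open image of `Π''` in `G_K`), which acts on `Δ` as the scalar `χ(π̄) ≠ 1`
  have hstar : E.StarCondition := by
    refine E.starCondition_of_conj_eq_mul j hrange fun P hP => ?_
    have hPo : IsOpen ((P.map E.aug.toMonoidHom : Subgroup E.gal) : Set E.gal) := by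
      rw [Subgroup.coe_map]
      exact Semidirect.isOpenMap_right hι _ hP
    obtain ⟨σ, hσP, hσ⟩ :=
      exists_mem_cyclotomicCharacter_ne_one_of_isOpen p K ℓ (P.map E.aug.toMonoidHom) hPo
    obtain ⟨π, hπP, hπσ⟩ := Subgroup.mem_map.mp hσP
    refine ⟨π, hπP, ((χ σ : ℤ_[ℓ]ˣ) : ℤ_[ℓ]), fun h => hσ (Units.val_eq_one.mp h), fun a => ?_⟩
    have h := hconj π a
    have hr : i (E.aug π) = σ := hπσ
    rw [hr] at h
    exact h
  -- (d) rank constancy, (e) Thm 2.6 (v), by the landed derivations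
  refine ⟨E, i, j, hinj, hrange, hconj, hsplit, htfg, hne, hstar,
    coinvariantRankConstant_of_mlfBase E B hsplit hstar, ?_⟩
  exact E.thm26v_of_starCondition B hsplit htfg hstar

end FundamentalExtension

end Literature.AnabelianGeometry.AbsoluteAnabelian

end
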